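import Literature.Computability.QuantumComplexity.BPPRelSubsetBQPRel
import Literature.Computability.QuantumComplexity.CoinFamilyKernelProofs
import Literature.Computability.Complexity.OracleBPP
import HarnessLib

/-!
# `BPP^A ⊆ BQP^A` and `P^A ⊆ BQP^A` for every oracle language `A` — discharges

Topic `Literature/Computability/QuantumComplexity`; proof companion (theorems only, no
definitions) of `CountingSimulationRel.lean`, discharging its two Bernstein–Vazirani leaves:

* `BPPRel_ofLanguage_subset_BQPRel_holds` — the named fact `BPPRel_ofLanguage_subset_BQPRel`
  (`∀ A, BPP^A ⊆ BQP^A`; Bernstein–Vazirani 1997, Thm. 8.3 `BPP ⊆ BQP`, carried out with the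
  oracle track of their §8.3): the proved reduction `BPPRel_ofLanguage_subset_BQPRel_of_sim`
  (`BPPRelSubsetBQPRel.lean`: Hadamard coins, the uniform reversible simulation of the `bp`
  witness machine with one XOR-query gate per oracle query, first output wire read off the
  kernel) applied to the discharged relativized uniform reversible simulation
  `uniformOracleCoinSimulation_holds` (`CoinFamilyKernelProofs.lean`);
* `PRel_ofLanguage_subset_BQPRel_holds` — the named fact `PRel_ofLanguage_subset_BQPRel`
  (`∀ A, P^A ⊆ BQP^A`; Bernstein–Vazirani 1997, Thm. 8.2 with Thm. 8.3), from the previous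
  theorem and the discharged `P^O ⊆ BPP^O` (`PRel_subset_BPPRel_holds`, `Complexity/OracleBPP.lean`)
  through the proved `PRel_ofLanguage_subset_BQPRel_of_BPPRel`.

`CountingSimulationRel.lean` itself cannot hold these proofs (`BPPRelSubsetBQPRel.lean` imports
it), hence this sibling file; nothing here is new mathematics beyond composing tree theorems.

## References

* E. Bernstein, U. Vazirani, *Quantum complexity theory*, SIAM J. Comput. 26 (1997) 1411–1473:
  Thm. 8.2 (`P ⊆ EQP ⊆ BQP`) and Thm. 8.3 (`BPP ⊆ BQP`, proof: "superposition split equally among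
  all `|x⟩|y⟩` … running this deterministic algorithm … observing the bit on the third track gives
  the proper classification with probability at least `2/3`"), p. 1451; §8.3 *Oracle QTMs*,
  p. 1455 (query track `|x·b⟩ ↦ |x·b ⊕ f(x)⟩`, "just as in a classical oracle machine")
  [BernsteinVazirani1997SICOMP].
* L. Fortnow, J. Rogers, *Complexity limitations on quantum computation*, J. Comput. System
  Sci. 59 (1999) 240–252, proof of Thm. 4.2 (the relativized use: "and so `P = BPP = BQP`")
  [FortnowRogers1999JCSS].
-/

namespace Literature.Computability.QuantumComplexity

open _root_.Computability Complexity Cryptography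

/-- **`BPP^A ⊆ BQP^A` for every oracle language `A`** — discharge of the named fact
`BPPRel_ofLanguage_subset_BQPRel` (Bernstein–Vazirani's Thm. 8.3 `BPP ⊆ BQP`, relativized with
the oracle track of §8.3): the proved reduction `BPPRel_ofLanguage_subset_BQPRel_of_sim` fed with
the discharged relativized uniform reversible simulation `uniformOracleCoinSimulation_holds`.
[cite: BernsteinVazirani1997SICOMP, Thm. 8.3 (p. 1451, proof) with §8.3 (p. 1455, oracle QTMs)] -/
theorem BPPRel_ofLanguage_subset_BQPRel_holds : BPPRel_ofLanguage_subset_BQPRel :=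
  BPPRel_ofLanguage_subset_BQPRel_of_sim uniformOracleCoinSimulation_holds

/-- **`P^A ⊆ BQP^A` for every oracle language `A`** — discharge of the named fact
`PRel_ofLanguage_subset_BQPRel` (Bernstein–Vazirani's Thm. 8.2 `P ⊆ EQP ⊆ BQP`, relativized),
from `BPP^A ⊆ BQP^A` (`BPPRel_ofLanguage_subset_BQPRel_holds`) and the discharged `P^O ⊆ BPP^O`
(`PRel_subset_BPPRel_holds`). [cite: BernsteinVazirani1997SICOMP, Thm. 8.2 and Thm. 8.3 (p. 1451) with §8.3 (p. 1455)] -/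
theorem PRel_ofLanguage_subset_BQPRel_holds : PRel_ofLanguage_subset_BQPRel :=
  PRel_ofLanguage_subset_BQPRel_of_BPPRel BPPRel_ofLanguage_subset_BQPRel_holds
    PRel_subset_BPPRel_holds

end Literature.Computability.QuantumComplexity
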